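import Mathlib
import Literature.NumberTheory.Transcendental.ZagierDilogarithmConjecture
import Literature.NumberTheory.Transcendental.BlochWignerDilogarithm
import Literature.NumberTheory.Transcendental.BlochWignerDilogarithmProofs
import Summits.KontsevichZagierPeriods.KontsevichZagierPeriods.Theorems.HyperbolicBlochZagierDilogarithmConjectureStubDistributionSlice
import HarnessLib

/-!
# `ZagierDilogarithmConjecture` (stmt-KontsevichZagierPeriods-10550) — line `kummer-clausen-linearisation`
(reshape c5, "the cyclotomic tower and the abelian sector"), stub `stub_cyclotomicSpanning`

**Weight-2 Kubert spanning of the roots of unity modulo Zagier's relators (UNCONDITIONAL).** Let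
`ζ_N = e^{2πi/N}` (`N ≥ 1`) and `R̄ = ⟨dilogRelators⟩ ⊆ ℤ[ℂ]` the relator group of Zagier's
dilogarithm conjecture. For every residue `c mod N` there are an integer `M ≥ 1` and integers `b_a`
supported on the UNITS `a ∈ (ℤ/N)ˣ` with

`M · [ζ_N^c] − Σ_a b_a [ζ_N^a] ∈ R̄`,

i.e. every (possibly imprimitive) `N`-th root of unity class is, up to a positive multiple, a
`ℤ`-combination of primitive ones modulo the relators. This is the input of the folding step
`stub_cyclotomicFolding` of the line (level-`N` cyclotomic sector ⇔ Milnor_N for composite `N`).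

Proof. Let `G ⊆ ℤ[ℂ]` be the set of classes `x` having a positive multiple `M • x` in
`R̄ + ⟨[ζ_N^a] : a unit⟩`; `G` is a subgroup, contains `R̄`, is saturated (`M • x ∈ G ⇒ x ∈ G`) and
contains `[y]` for every PRIMITIVE `N`-th root of unity `y` (`y = ζ_N^i`, `(i, N) = 1`, so `i` is a unit
mod `N`). We show `[y] ∈ G` for every `N`-th root of unity `y`, by strong induction on the cofactor
`d = N / ord(y)`: for `d > 1` pick a prime `p ∣ d` and let `n = ord(y)`; by induction all roots of unity
of exact order `pn` have their class in `G`. The only relators used are the DISTRIBUTION relators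
`[xᵖ] − p Σ_{m<p} [ζ_pᵐ x] ∈ R̄` (`stub_distributionSlice`, tree, reshape c2).
* If `p ∣ n`: take `x = y^{1/p}`; every `ζ_pᵐ x` is a `p`-th root of `y`, hence of exact order `pn`,
  so `[y] ≡ p Σ_m [ζ_pᵐ x]` lies in `G`.
* If `p ∤ n`: for every `y'` of exact order `n`, `ζ_pᵐ y'` (`0 < m < p`) has exact order `pn`, so the
  distribution relator at `y'` gives `T(y') = p[y'] − [y'ᵖ] ∈ G`; along the Frobenius orbit
  `yᵢ = y^{pⁱ}` (all of exact order `n`) the `T(yᵢ)` telescope to `pⁱ[y] − [y^{pⁱ}] ∈ G`; with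
  `r = φ(n)`, `pʳ ≡ 1 (mod n)` (Euler), so `(pʳ − 1)[y] ∈ G` and `[y] ∈ G` by saturation.
Finally unpack `M • [ζ_N^c] ∈ R̄ + ⟨[ζ_N^a] : a unit⟩`. Sorry-free; axioms ⊆ {propext, Classical.choice,
Quot.sound}.

## References

* W. D. Neumann, *Hilbert's 3rd problem and invariants of 3-manifolds*, Geom. Topol. Monogr. 1 (1998),
  §2.1. [Neumann1998]
* J. L. Dupont, *Scissors congruences, group homology and characteristic classes*, World Scientific
  (2001), Cor. 8.15 (the distribution relation). [Dupont2001]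
* J. Milnor, *On polylogarithms, Hurwitz zeta functions, and the Kubert identities*, Enseign. Math. 29
  (1983), §§2–3 (Kubert/distribution relations among values at roots of unity). [Milnor1983]
-/

noncomputable section

open scoped BigOperators ComplexConjugate
open Literature.NumberTheory.Transcendental

namespace Summit.KontsevichZagierPeriods.HyperbolicBloch.ZagierDilogarithmCyclotomic

open Summit.KontsevichZagierPeriods.HyperbolicBloch.ZagierDilogarithmGaloisDescent
  (stub_distributionSlice)
open FreeAbelianGroup (of)

namespace CyclotomicSpanning

/-! ### Roots of unity: algebraicity and exact orders -/

/-- A root of unity is algebraic over `ℚ` (root of `Xᴷ − 1`). [folklore] -/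
theorem isAlgebraic_of_pow_eq_one {x : ℂ} {K : ℕ} (hK : 0 < K) (hx : x ^ K = 1) :
    IsAlgebraic ℚ x := by
  refine ⟨Polynomial.X ^ K - 1, Polynomial.X_pow_sub_C_ne_zero hK 1, ?_⟩
  simp [hx]

/-- If `y` has exact order `n`, `p` is a prime dividing `n` and `xᵖ = y`, then `x` has exact order
`p·n`. [folklore] -/
theorem isPrimitiveRoot_of_pow_eq {p n : ℕ} (hp : p.Prime) (hpn : p ∣ n) {x y : ℂ}
    (hy : IsPrimitiveRoot y n) (hx : x ^ p = y) : IsPrimitiveRoot x (p * n) := by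
  have hx' := IsPrimitiveRoot.orderOf x
  have hdvd1 : n ∣ orderOf x := by
    have h := orderOf_pow_dvd (x := x) p
    rwa [hx, ← hy.eq_orderOf] at h
  have hpdvd : p ∣ orderOf x := dvd_trans hpn hdvd1
  have h2 : IsPrimitiveRoot (x ^ p) (orderOf x / p) := hx'.pow_of_dvd hp.ne_zero hpdvd
  rw [hx] at h2
  have h3 : orderOf x / p = n := h2.unique hy
  have h4 : orderOf x = p * n := by rw [← h3, Nat.mul_div_cancel' hpdvd]
  rwa [h4] at hx'

/-- If `y` has exact order `n`, `p` is a prime NOT dividing `n` and `0 < m < p`, then `ζ_pᵐ · y` has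
exact order `p·n` (product of commuting elements of coprime orders `p` and `n`). [folklore] -/
theorem isPrimitiveRoot_zeta_pow_mul {p n m : ℕ} (hp : p.Prime) (hcop : p.Coprime n) (hm0 : m ≠ 0)
    (hmp : m < p) {y : ℂ} (hy : IsPrimitiveRoot y n) :
    IsPrimitiveRoot (Complex.exp (2 * Real.pi * Complex.I / p) ^ m * y) (p * n) := by
  have hζ : IsPrimitiveRoot (Complex.exp (2 * Real.pi * Complex.I / p) ^ m) p :=
    (Complex.isPrimitiveRoot_exp p hp.ne_zero).pow_of_coprime m
      (Nat.coprime_of_lt_prime hm0 hmp hp).symm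
  have h1 : orderOf (Complex.exp (2 * Real.pi * Complex.I / p) ^ m) = p := hζ.eq_orderOf.symm
  have h2 : orderOf y = n := hy.eq_orderOf.symm
  have hco : (orderOf (Complex.exp (2 * Real.pi * Complex.I / p) ^ m)).Coprime (orderOf y) := by
    rw [h1, h2]; exact hcop
  have hord := Commute.orderOf_mul_eq_mul_orderOf_of_coprime (Commute.all _ _) hco
  rw [h1, h2] at hord
  rw [← hord]
  exact IsPrimitiveRoot.orderOf _

/-! ### The two moves of the induction -/

variable {G : AddSubgroup (FreeAbelianGroup ℂ)}

/-- **Root-taking move (`p ∣ n`).** If all classes of roots of unity of exact order `p·n` lie in a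
subgroup `G ⊇ ⟨dilogRelators⟩` and `p ∣ n`, then so does the class of every `y` of exact order `n`:
with `x = y^{1/p}` the distribution relator reads `[y] ≡ p Σ_{m<p} [ζ_pᵐ x]`, and every `ζ_pᵐ x` is
a `p`-th root of `y`, of exact order `p·n`. [folklore] -/
theorem of_mem_of_dvd (hR : AddSubgroup.closure dilogRelators ≤ G) {p n : ℕ} (hp : p.Prime)
    (hn : 0 < n) (hpn : p ∣ n) (hG : ∀ x : ℂ, IsPrimitiveRoot x (p * n) → of x ∈ G) {y : ℂ}
    (hy : IsPrimitiveRoot y n) : of y ∈ G := by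
  set x : ℂ := y ^ ((p : ℂ)⁻¹)
  have hx : x ^ p = y := Complex.cpow_nat_inv_pow y hp.ne_zero
  have hxalg : IsAlgebraic ℚ x :=
    isAlgebraic_of_pow_eq_one (mul_pos hp.pos hn) (by rw [pow_mul, hx, hy.pow_eq_one])
  have hdist := hR (stub_distributionSlice p hp.pos x hxalg)
  rw [hx] at hdist
  have hsum : ∑ m ∈ Finset.range p, of (Complex.exp (2 * Real.pi * Complex.I / p) ^ m * x) ∈ G := by
    refine sum_mem fun m _ => hG _ (isPrimitiveRoot_of_pow_eq hp hpn hy ?_)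
    rw [mul_pow, ← pow_mul, mul_comm m p, pow_mul,
      (Complex.isPrimitiveRoot_exp p hp.ne_zero).pow_eq_one, one_pow, one_mul, hx]
  have := add_mem hdist (nsmul_mem hsum p)
  rwa [sub_add_cancel] at this

/-- **Frobenius step (`p ∤ n`).** If all classes of roots of unity of exact order `p·n` lie in a
subgroup `G ⊇ ⟨dilogRelators⟩` and `p ∤ n`, then `p·[y] − [yᵖ] ∈ G` for every `y` of exact order `n`:
in the distribution relator `[yᵖ] − p Σ_{m<p} [ζ_pᵐ y]` the term `m = 0` is `[y]` and the others are
classes of exact order `p·n`. [folklore] -/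
theorem nsmul_of_sub_of_pow_mem (hR : AddSubgroup.closure dilogRelators ≤ G) {p n : ℕ}
    (hp : p.Prime) (hn : 0 < n) (hcop : p.Coprime n)
    (hG : ∀ x : ℂ, IsPrimitiveRoot x (p * n) → of x ∈ G) {y : ℂ} (hy : IsPrimitiveRoot y n) :
    p • of y - of (y ^ p) ∈ G := by
  have hyalg : IsAlgebraic ℚ y := isAlgebraic_of_pow_eq_one hn hy.pow_eq_one
  have hdist := hR (stub_distributionSlice p hp.pos y hyalg)
  rw [Finset.sum_range_eq_add_Ico _ hp.pos, pow_zero, one_mul] at hdist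
  have hS : ∑ m ∈ Finset.Ico 1 p, of (Complex.exp (2 * Real.pi * Complex.I / p) ^ m * y) ∈ G := by
    refine sum_mem fun m hm => hG _ ?_
    rw [Finset.mem_Ico] at hm
    exact isPrimitiveRoot_zeta_pow_mul hp hcop (Nat.one_le_iff_ne_zero.1 hm.1) hm.2 hy
  have := sub_mem (neg_mem hdist) (nsmul_mem hS p)
  convert this using 1
  rw [smul_add]
  abel

/-- **Frobenius orbit (`p ∤ n`).** Under the hypotheses of `nsmul_of_sub_of_pow_mem`, the class of
every `y` of exact order `n` lies in `G` provided `G` is saturated: the steps `p·[yᵢ] − [yᵢ₊₁]` along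
`yᵢ = y^{pⁱ}` telescope to `pⁱ·[y] − [y^{pⁱ}] ∈ G`, and `y^{p^{φ(n)}} = y` (Euler), so
`(p^{φ(n)} − 1)·[y] ∈ G`. [folklore] -/
theorem of_mem_of_not_dvd (hR : AddSubgroup.closure dilogRelators ≤ G)
    (hsat : ∀ (M : ℕ) (x : FreeAbelianGroup ℂ), 0 < M → M • x ∈ G → x ∈ G) {p n : ℕ}
    (hp : p.Prime) (hn : 0 < n) (hcop : p.Coprime n)
    (hG : ∀ x : ℂ, IsPrimitiveRoot x (p * n) → of x ∈ G) {y : ℂ} (hy : IsPrimitiveRoot y n) :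
    of y ∈ G := by
  -- telescoping along the Frobenius orbit
  have htel : ∀ i : ℕ, p ^ i • of y - of (y ^ p ^ i) ∈ G := by
    intro i
    induction i with
    | zero => simp
    | succ i ih =>
      have hyi : IsPrimitiveRoot (y ^ p ^ i) n := hy.pow_of_coprime _ (Nat.Coprime.pow_left i hcop)
      have hstep := nsmul_of_sub_of_pow_mem hR hp hn hcop hG hyi
      have e : p ^ (i + 1) • of y - of (y ^ p ^ (i + 1)) =
          p • (p ^ i • of y - of (y ^ p ^ i)) + (p • of (y ^ p ^ i) - of ((y ^ p ^ i) ^ p)) := by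
        rw [← pow_mul, ← pow_succ, pow_succ', mul_smul, smul_sub]
        abel
      rw [e]
      exact add_mem (nsmul_mem ih p) hstep
  -- Euler: `p ^ φ(n) ≡ 1 (mod n)`, so the orbit closes up
  have hr0 : 0 < Nat.totient n := Nat.totient_pos.2 hn
  have hmod : p ^ Nat.totient n ≡ 1 [MOD n] := Nat.ModEq.pow_totient hcop
  have hypow : y ^ p ^ Nat.totient n = y := by
    have h' : p ^ Nat.totient n % orderOf y = 1 % orderOf y := by rw [← hy.eq_orderOf]; exact hmod
    rw [← pow_mod_orderOf, h', pow_mod_orderOf, pow_one]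
  have h1 : 1 ≤ p ^ Nat.totient n := Nat.one_le_pow _ _ hp.pos
  have hlt : 1 < p ^ Nat.totient n := lt_of_lt_of_le hp.one_lt (Nat.le_self_pow hr0.ne' p)
  refine hsat (p ^ Nat.totient n - 1) _ (Nat.sub_pos_of_lt hlt) ?_
  rw [sub_nsmul _ h1, one_smul, ← sub_eq_add_neg]
  have := htel (Nat.totient n)
  rwa [hypow] at this

/-! ### The induction on the cofactor `N / ord` -/

/-- **Kubert spanning, abstract form.** Let `G ⊆ ℤ[ℂ]` be a saturated subgroup containing
`⟨dilogRelators⟩` and the classes of all PRIMITIVE `N`-th roots of unity. Then `G` contains the class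
of every root of unity `y` of exact order `n` with `n · d = N` — strong induction on the cofactor `d`,
using `of_mem_of_dvd` / `of_mem_of_not_dvd` at a prime `p ∣ d`. [folklore] -/
theorem of_mem_of_isPrimitiveRoot (hR : AddSubgroup.closure dilogRelators ≤ G)
    (hsat : ∀ (M : ℕ) (x : FreeAbelianGroup ℂ), 0 < M → M • x ∈ G → x ∈ G) {N : ℕ} (hN : 0 < N)
    (hprim : ∀ y : ℂ, IsPrimitiveRoot y N → of y ∈ G) :
    ∀ (d n : ℕ), n * d = N → ∀ y : ℂ, IsPrimitiveRoot y n → of y ∈ G := by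
  intro d
  induction d using Nat.strong_induction_on with
  | h d ih =>
    intro n hnd y hy
    have hn : 0 < n := Nat.pos_of_ne_zero fun h => by rw [h, zero_mul] at hnd; omega
    rcases Nat.lt_or_ge d 2 with hd | hd
    · interval_cases d
      · rw [mul_zero] at hnd; omega
      · rw [mul_one] at hnd
        subst hnd
        exact hprim y hy
    · obtain ⟨p, hp, d', rfl⟩ := Nat.exists_prime_and_dvd (show d ≠ 1 by omega)
      have hd'0 : 0 < d' := Nat.pos_of_ne_zero fun h => by rw [h, mul_zero, mul_zero] at hnd; omega
      have hlt : d' < p * d' := (lt_mul_iff_one_lt_left hd'0).2 hp.one_lt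
      have hG : ∀ x : ℂ, IsPrimitiveRoot x (p * n) → of x ∈ G :=
        fun x hx => ih d' hlt (p * n) (by rw [← hnd]; ring) x hx
      by_cases hpn : p ∣ n
      · exact of_mem_of_dvd hR hp hn hpn hG hy
      · exact of_mem_of_not_dvd hR hsat hp hn (hp.coprime_iff_not_dvd.2 hpn) hG hy

/-- **Kubert spanning, abstract form, for all `N`-th roots of unity.** With `G` as in
`of_mem_of_isPrimitiveRoot`, `[y] ∈ G` whenever `yᴺ = 1`. [folklore] -/
theorem of_mem_of_pow_eq_one (hR : AddSubgroup.closure dilogRelators ≤ G)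
    (hsat : ∀ (M : ℕ) (x : FreeAbelianGroup ℂ), 0 < M → M • x ∈ G → x ∈ G) {N : ℕ} (hN : 0 < N)
    (hprim : ∀ y : ℂ, IsPrimitiveRoot y N → of y ∈ G) (y : ℂ) (hy : y ^ N = 1) : of y ∈ G := by
  obtain ⟨d, hd⟩ := orderOf_dvd_of_pow_eq_one hy
  exact of_mem_of_isPrimitiveRoot hR hsat hN hprim d (orderOf y) hd.symm y (IsPrimitiveRoot.orderOf y)

/-! ### The saturation of a subgroup, and unpacking unit combinations -/

/-- The saturation `{x | ∃ M ≥ 1, M • x ∈ H}` of a subgroup `H` of an abelian group is a subgroup.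
[folklore] -/
theorem exists_saturation {A : Type*} [AddCommGroup A] (H : AddSubgroup A) :
    ∃ G : AddSubgroup A, ∀ x, x ∈ G ↔ ∃ M : ℕ, 0 < M ∧ M • x ∈ H := by
  refine ⟨{ carrier := {x | ∃ M : ℕ, 0 < M ∧ M • x ∈ H}
            add_mem' := ?_
            zero_mem' := ⟨1, one_pos, by rw [smul_zero]; exact H.zero_mem⟩
            neg_mem' := ?_ }, fun x => Iff.rfl⟩
  · rintro x y ⟨M₁, hM₁, h₁⟩ ⟨M₂, hM₂, h₂⟩
    refine ⟨M₂ * M₁, mul_pos hM₂ hM₁, ?_⟩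
    rw [smul_add, mul_smul, mul_smul, smul_comm M₂ M₁ y]
    exact H.add_mem (H.nsmul_mem h₁ _) (H.nsmul_mem h₂ _)
  · rintro x ⟨M, hM, h⟩
    exact ⟨M, hM, by rw [smul_neg]; exact H.neg_mem h⟩

/-- An element of the subgroup generated by the unit classes `[ζ^a]`, `a ∈ (ℤ/N)ˣ`, is a
`ℤ`-combination `Σ_a b_a [ζ^a]` with `b` supported on the units. [folklore] -/
theorem exists_coeffs_of_mem_closure {N : ℕ} [NeZero N] (ζ : ℂ) {k : FreeAbelianGroup ℂ}
    (hk : k ∈ AddSubgroup.closure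
      (Set.range fun u : (ZMod N)ˣ => of (ζ ^ (u : ZMod N).val))) :
    ∃ b : ZMod N → ℤ, (∀ a, b a ≠ 0 → IsUnit a) ∧ k = ∑ a : ZMod N, b a • of (ζ ^ a.val) := by
  classical
  induction hk using AddSubgroup.closure_induction with
  | mem x hx =>
    obtain ⟨u, rfl⟩ := hx
    refine ⟨Pi.single (u : ZMod N) 1, fun a ha => ?_, ?_⟩
    · by_contra hna
      apply ha
      rw [Pi.single_eq_of_ne]
      rintro rfl
      exact hna u.isUnit
    · rw [Finset.sum_eq_single (u : ZMod N) (fun a _ ha => by rw [Pi.single_eq_of_ne ha, zero_smul])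
        (fun h => absurd (Finset.mem_univ _) h), Pi.single_eq_same, one_smul]
  | zero => exact ⟨0, fun a ha => absurd rfl ha, by simp⟩
  | add x y _ _ ihx ihy =>
    obtain ⟨b₁, hb₁, rfl⟩ := ihx
    obtain ⟨b₂, hb₂, rfl⟩ := ihy
    refine ⟨b₁ + b₂, fun a ha => ?_, ?_⟩
    · by_cases h1 : b₁ a = 0
      · refine hb₂ a ?_
        simpa [h1] using ha
      · exact hb₁ a h1
    · simp only [Pi.add_apply, add_smul, Finset.sum_add_distrib]
  | neg x _ ih =>
    obtain ⟨b, hb, rfl⟩ := ih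
    refine ⟨-b, fun a ha => hb a (by simpa using ha), ?_⟩
    simp only [Pi.neg_apply, neg_smul, Finset.sum_neg_distrib]

end CyclotomicSpanning

open CyclotomicSpanning

/-! ### The stub -/

/-- **Stub `stub_cyclotomicSpanning` (c5): weight-2 Kubert spanning modulo the relators
(UNCONDITIONAL).** For every `N ≥ 1` and every residue `c mod N` there are `M ≥ 1` and integers `b_a`
supported on the UNITS `a ∈ (ℤ/N)ˣ` with `M·[ζ_N^c] − Σ_a b_a [ζ_N^a] ∈ ⟨dilogRelators⟩`
(`ζ_N = e^{2πi/N}`). Proof: the saturation `G` of `⟨dilogRelators⟩ + ⟨[ζ_N^a] : a unit⟩` contains the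
classes of the primitive `N`-th roots of unity, hence (`of_mem_of_pow_eq_one`: distribution relators
`stub_distributionSlice` + the Frobenius-orbit telescoping) of all `N`-th roots of unity — the
weight-2 case of the spanning of Kubert's universal distribution by primitive roots of unity.
[cite: Milnor1983, §§2–3 (Kubert identities)] -/
theorem stub_cyclotomicSpanning :
    ∀ (N : ℕ) [NeZero N] (c : ZMod N), ∃ M : ℕ, 0 < M ∧ ∃ b : ZMod N → ℤ, (∀ a, b a ≠ 0 → IsUnit a) ∧
      (M • FreeAbelianGroup.of (Complex.exp (2 * Real.pi * Complex.I / N) ^ c.val) -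
        ∑ a : ZMod N, b a • FreeAbelianGroup.of (Complex.exp (2 * Real.pi * Complex.I / N) ^ a.val)) ∈
        AddSubgroup.closure dilogRelators := by
  intro N _ c
  classical
  set ζ : ℂ := Complex.exp (2 * Real.pi * Complex.I / N)
  have hζ : IsPrimitiveRoot ζ N := Complex.isPrimitiveRoot_exp N (NeZero.ne N)
  set R : AddSubgroup (FreeAbelianGroup ℂ) := AddSubgroup.closure dilogRelators
  set K : AddSubgroup (FreeAbelianGroup ℂ) :=
    AddSubgroup.closure (Set.range fun u : (ZMod N)ˣ => of (ζ ^ (u : ZMod N).val))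
  obtain ⟨G, hG⟩ := exists_saturation (R ⊔ K)
  have hR : R ≤ G := fun x hx =>
    (hG x).2 ⟨1, one_pos, by rw [one_smul]; exact AddSubgroup.mem_sup_left hx⟩
  have hsat : ∀ (M : ℕ) (x : FreeAbelianGroup ℂ), 0 < M → M • x ∈ G → x ∈ G := by
    intro M x hM hx
    obtain ⟨M', hM', h⟩ := (hG _).1 hx
    exact (hG x).2 ⟨M' * M, mul_pos hM' hM, by rwa [mul_smul]⟩
  have hprim : ∀ y : ℂ, IsPrimitiveRoot y N → of y ∈ G := by
    intro y hy
    obtain ⟨i, hi, rfl⟩ := hζ.eq_pow_of_pow_eq_one hy.pow_eq_one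
    have hcop : i.Coprime N := (hζ.pow_iff_coprime (NeZero.pos N) i).1 hy
    have hu : IsUnit ((i : ℕ) : ZMod N) := (ZMod.isUnit_iff_coprime i N).2 hcop
    refine (hG _).2 ⟨1, one_pos, ?_⟩
    rw [one_smul]
    refine AddSubgroup.mem_sup_right (AddSubgroup.subset_closure ⟨hu.unit, ?_⟩)
    simp only [IsUnit.unit_spec, ZMod.val_cast_of_lt hi]
  have hmem : of (ζ ^ c.val) ∈ G :=
    of_mem_of_pow_eq_one hR hsat (NeZero.pos N) hprim _
      (by rw [← pow_mul, mul_comm, pow_mul, hζ.pow_eq_one, one_pow])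
  obtain ⟨M, hM, hMx⟩ := (hG _).1 hmem
  obtain ⟨r, hr, k, hk, hrk⟩ := AddSubgroup.mem_sup.1 hMx
  obtain ⟨b, hb, rfl⟩ := exists_coeffs_of_mem_closure ζ hk
  refine ⟨M, hM, b, hb, ?_⟩
  rw [← hrk, add_sub_cancel_right]
  exact hr

end Summit.KontsevichZagierPeriods.HyperbolicBloch.ZagierDilogarithmCyclotomic

end
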